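/-
Copyright: statement-level skeleton of a published paper (lit-balaban cell, Phase-2 proof seat p10, gen 4). No proof claims
beyond what the kernel checks below.
-/
import Mathlib
import Literature.MathematicalPhysics.QuantumFieldTheory.BalabanImbrieJaffe1984to88.BIJ85Eq7113DerivationPart3

/-!
# `BalabanImbrieJaffe1984to88.BIJ85Eq7113DerivationPart4` — T. Bałaban, J. Imbrie, A. Jaffe, *Renormalization of the Higgs model:
minimizers, propagators and the stability of mean field theory*, Commun. Math. Phys. **97** (1985) 299–329
[BalabanImbrieJaffe1985]: p. 305 (2.19)/(2.24) and p. 310 (4.2.2) AT THE FIBRE — **the block-averaging identities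
QQ^{s*} = I, Q^e_kQ^{e*}_k = η^{−2}I, Q^s_kQ^{s*}_k = η^{−1}I for the momentum weights of file 1/3, PROVED over the full shift set
l ∈ 2πZ^d, |l_i| ≤ πn (n = 2M + 1), and the second form of (4.2.2)/(7.1.12): ⟨f, σ_k(p′)f⟩ = η^{−2}‖f‖² − ‖∂G_{k,Ax}∂^*Q^{e*}_kf‖²**
(file 4 of the derivation (7.1.12) ⟹ (7.1.13); theorems + one scalar abbreviation)

statement-level skeleton of published theorems with citation tags; proofs where landed; nothing here is a claim about
the Yang–Mills mass gap

CITATION HEADER (lean-in-tree rule).  Part of the lit-balaban TYPED SKELETON (HOME `run/shared/lean/pub/lit-balaban/`); WHAT IS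
REPRODUCED: for SKELETON rows **C1.Eq4.2.1-4.2.2** (p. 310 [PDF 12], verbatim: *"σ_k = Q^e_k(I − ∂G_{k,Ax}∂^*)Q^{e*}_k =
η^{−2}I − Q^e_k∂G_{k,Ax}∂^*Q^{e*}_k. (4.2.2) Here we have used Q^e_kQ^{e*}_k = η^{−2}, see (2.24)."*), **C1.Eq2.19** / **C1.Eq2.24**
(p. 305 [PDF 7], verbatim: *"QQ^{s*} = I. (2.19)"*, *"Q^e_kQ^{e*}_k = L^{2k}I = η^{−2}I, Q^s_kQ^{s*}_k = L^kI = η^{−1}I, (2.24) where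
η = L^{−k}"*) and the derivation rows **C1.Eq7.1.13-7.1.19** / **C1.Thm7.1.1** of `HOME/lit-balaban-r15/ROWS-C1.md` (fold owner r15,
referee ref-5): the momentum-space (fibrewise) content of these identities for the weights of `BIJ85Eq7113Derivation` (file 1/3 —
bond weight r = u·v_ν of [6I] (1.61), surface weight s = u/v̄_ν, edge weight w = u/(v̄_μv̄_ν); see the weight convention note there),
over r15's FULL index set `lShifts d M` with n = 2M + 1 (the printed range *"l ∈ 2πZ^d, |l_i| ≤ π/η"* for L odd).  Kind «kernel
identities validating a typed reading»; they are what the header of file 1/3 asserts in prose.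
WHAT IS PROVED (zero `sorry`, standard axioms).  §1 the orthogonality of the n-th roots of unity over the symmetric residue system
|t| ≤ M: Σ_{|t|≤M} e^{2πikt/n} = n·[k = 0] for |k| < n (`sum_root_unity`, kernel).  §2 `v1 n x := n^{−1}Σ_{j<n}e^{ijx/n}` = this
seat's block-average symbol `vC` read coordinatewise (`vC_eq_v1`), and **Σ_{|t|≤M} |v1(x + 2πt)|² = 1 for every real x**
(`sum_norm_v1_sq`).  §3 over the full shift set, for EVERY p′: **Σ_l |u(p′+l)|² = 1** (`sum_norm_uC_sq`, [6I] p. 23); at every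
generic p′ (all 0 < |p′_μ| ≤ π, where file 1/3's `vSym`-weights are the block averages, `norm_vSym_sq_eq`): **(2.19) Σ_l r_ν s̄_ν = 1**
(`sum_rQ_mul_conj_sW`), **(2.24) Σ_l |s_ν|² = n = η^{−1}** (`sum_norm_sW_sq`) and **Σ_l |w_{μν}|² = n² = η^{−2}** for μ ≠ ν
(`sum_norm_wE_sq`).  §4 hence ‖Q^{e*}_kf‖² = η^{−2}‖f‖² for every two-form (`pNormSq_qeStar`; ‖f‖² = ½Σ_{μν}|f_{μν}|² in the plaquette
pairing (2.20)) and **`sigmaMin_eq_second_form`: ⟨f, σ_k(p′)f⟩ = η^{−2}‖f‖² − ‖∂A*‖²**, ∂A* = the projection of Q^{e*}_kf onto the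
constrained curls (file 2/3 `normal_eq`), i.e. (4.2.2)'s *"η^{−2}I − Q^e_k∂G_{k,Ax}∂^*Q^{e*}_k"* at the fibre.
NOT CLAIMED: as in file 1/3 — that these weights ARE the symbols of the configuration-space operators (2.13)/(2.16)/(2.21) (p27's
lane); the identities here show that they satisfy the printed operator identities (2.19)/(2.24) exactly.
Unit `lit-balaban-p10` (gen 4), HOME as above.
-/

namespace Literature.MathematicalPhysics.QuantumFieldTheory.BalabanImbrieJaffe1984to88.BIJ85Eq7113DerivationPart4

open scoped BigOperators Real ComplexConjugate
open Complex Finset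
open Literature.MathematicalPhysics.QuantumFieldTheory.BalabanImbrieJaffe1984to88.BIJ85MomentumSymbols71
open Literature.MathematicalPhysics.QuantumFieldTheory.BalabanImbrieJaffe1984to88.BIJ85CurlComplement719
open Literature.MathematicalPhysics.QuantumFieldTheory.BalabanImbrieJaffe1984to88.BIJ85Thm711Fibrewise
open Literature.MathematicalPhysics.QuantumFieldTheory.BalabanImbrieJaffe1984to88.BIJ85SigmaClosedCube
open Literature.MathematicalPhysics.QuantumFieldTheory.BalabanImbrieJaffe1984to88.BIJ85Eq7113Derivation
open Literature.MathematicalPhysics.QuantumFieldTheory.BalabanImbrieJaffe1984to88.BIJ85Eq7113DerivationPart2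
open Literature.MathematicalPhysics.QuantumFieldTheory.BalabanImbrieJaffe1984to88.BIJ85Eq7113DerivationPart3

noncomputable section

variable {d : ℕ}

/-! ## §1 Orthogonality of the n-th roots of unity over the symmetric residue system |t| ≤ M, n = 2M + 1 -/

/-- kernel: Σ_{t=−M}^{M} F(t) = Σ_{s<2M+1} F(s − M). [folklore] -/
private theorem sum_Icc_eq_sum_range (M : ℕ) (F : ℤ → ℂ) :
    ∑ t ∈ Finset.Icc (-(M : ℤ)) M, F t = ∑ s ∈ Finset.range (2 * M + 1), F ((s : ℤ) - M) := by
  refine Finset.sum_nbij' (fun t => (t + M).toNat) (fun s => (s : ℤ) - M) ?_ ?_ ?_ ?_ ?_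
  · intro t ht
    simp only [Finset.mem_Icc] at ht
    simp only [Finset.mem_range]
    omega
  · intro s hs
    simp only [Finset.mem_range] at hs
    simp only [Finset.mem_Icc]
    omega
  · intro t ht
    simp only [Finset.mem_Icc] at ht
    omega
  · intro s _
    simp
  · intro t ht
    simp only [Finset.mem_Icc] at ht
    congr 1
    omega

/-- kernel: e^{2πik/n} ≠ 1 for 0 < |k| < n. [folklore] -/
private theorem exp_ne_one_of_abs_lt {n : ℕ} {k : ℤ} (hk0 : k ≠ 0) (hk : |k| < n) :
    Complex.exp (2 * π * Complex.I * k / n) ≠ 1 := by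
  intro h
  obtain ⟨m, hm⟩ := Complex.exp_eq_one_iff.mp h
  have hn0 : (n : ℂ) ≠ 0 := by
    have : 0 < n := by
      have := abs_nonneg k
      exact_mod_cast (lt_of_le_of_lt this hk : (0 : ℤ) < n)
    exact_mod_cast this.ne'
  have hπ : (2 * π * Complex.I : ℂ) ≠ 0 := by
    have : (π : ℂ) ≠ 0 := Complex.ofReal_ne_zero.mpr Real.pi_pos.ne'
    simp [this, Complex.I_ne_zero]
  have hkm : (k : ℂ) = m * n := by
    field_simp at hm
    linear_combination hm
  have hkm' : k = m * n := by exact_mod_cast hkm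
  rcases eq_or_ne m 0 with hm0 | hm0
  · exact hk0 (by rw [hkm', hm0, zero_mul])
  · have h1 : (1 : ℤ) ≤ |m| := Int.one_le_abs hm0
    have h2 : |k| = |m| * n := by rw [hkm', abs_mul, Nat.abs_cast]
    have h3 : (n : ℤ) ≤ |k| := by rw [h2]; nlinarith
    exact absurd hk (not_lt.mpr h3)

/-- kernel: **Σ_{|t| ≤ M} e^{2πikt/n} = n·[k = 0]** for |k| < n = 2M + 1 (a complete residue system mod n). [folklore] -/
private theorem sum_root_unity (M : ℕ) {k : ℤ} (hk : |k| < (2 * M + 1 : ℕ)) :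
    ∑ t ∈ Finset.Icc (-(M : ℤ)) M, Complex.exp (2 * π * Complex.I * k * t / (2 * M + 1 : ℕ)) =
      if k = 0 then ((2 * M + 1 : ℕ) : ℂ) else 0 := by
  have hn0 : ((2 * M + 1 : ℕ) : ℂ) ≠ 0 := by exact_mod_cast (show 2 * M + 1 ≠ 0 by omega)
  split_ifs with hk0
  · subst hk0
    simp only [Int.cast_zero, mul_zero, zero_mul, zero_div, Complex.exp_zero, Finset.sum_const, Int.card_Icc,
      nsmul_eq_mul, mul_one]
    congr 1
    omega
  · rw [sum_Icc_eq_sum_range]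
    have hw1 : Complex.exp (2 * π * Complex.I * k / (2 * M + 1 : ℕ)) ≠ 1 := exp_ne_one_of_abs_lt hk0 hk
    have hwn : Complex.exp (2 * π * Complex.I * k / (2 * M + 1 : ℕ)) ^ (2 * M + 1) = 1 := by
      rw [← Complex.exp_nat_mul, show ((2 * M + 1 : ℕ) : ℂ) * (2 * π * Complex.I * k / (2 * M + 1 : ℕ)) =
        k * (2 * π * Complex.I) by field_simp]
      exact Complex.exp_int_mul_two_pi_mul_I k
    have hterm : ∀ s : ℕ, Complex.exp (2 * π * Complex.I * k * (((s : ℤ) - M : ℤ) : ℂ) / (2 * M + 1 : ℕ)) =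
        Complex.exp (2 * π * Complex.I * k / (2 * M + 1 : ℕ)) ^ s *
          Complex.exp (-(2 * π * Complex.I * k * M / (2 * M + 1 : ℕ))) := by
      intro s
      rw [← Complex.exp_nat_mul, ← Complex.exp_add]
      congr 1
      push_cast
      ring
    simp_rw [hterm]
    rw [← Finset.sum_mul, geom_sum_eq hw1, hwn, sub_self, zero_div, zero_mul]

/-! ## §2 The one-dimensional block-average symbol: Σ_{|t|≤M} |v(x + 2πt)|² = 1 -/

/-- The one-dimensional block-average symbol as a function of a scalar momentum: v(x) = n⁻¹Σ_{j<n} e^{ijx/n} (this seat's `vC`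
read coordinatewise: `vC n q μ = v1 n (q μ)`). [cite: BalabanImbrieJaffe1985, (7.1.7) p.322] -/
def v1 (n : ℕ) (x : ℝ) : ℂ := ((n : ℂ))⁻¹ * ∑ j ∈ Finset.range n, Complex.exp (Complex.I * ((((n : ℝ)⁻¹ * x : ℝ)) : ℂ)) ^ j

/-- `vC n q μ = v1 n (q μ)`. [cite: BalabanImbrieJaffe1985, (7.1.7) p.322] -/
theorem vC_eq_v1 (n : ℕ) (q : Fin d → ℝ) (μ : Fin d) : vC n q μ = v1 n (q μ) := rfl

/-- kernel: the phase a_j(x) = e^{ijx/n} has modulus 1: a_j ā_j = 1. [folklore] -/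
private theorem exp_pow_mul_conj (n j : ℕ) (x : ℝ) :
    Complex.exp (Complex.I * ((((n : ℝ)⁻¹ * x : ℝ)) : ℂ)) ^ j * conj (Complex.exp (Complex.I * ((((n : ℝ)⁻¹ * x : ℝ)) : ℂ)) ^ j) = 1 := by
  rw [map_pow, ← mul_pow, Complex.mul_conj, Complex.normSq_eq_norm_sq, Complex.norm_exp_I_mul_ofReal]
  simp

/-- kernel: at x + 2πt the j-th phase factorises: e^{ij(x+2πt)/n} = e^{ijx/n}·e^{2πijt/n}. [folklore] -/
private theorem exp_pow_shift (M j : ℕ) (x : ℝ) (t : ℤ) :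
    Complex.exp (Complex.I * (((((2 * M + 1 : ℕ) : ℝ)⁻¹ * (x + 2 * π * t) : ℝ)) : ℂ)) ^ j =
      Complex.exp (Complex.I * (((((2 * M + 1 : ℕ) : ℝ)⁻¹ * x : ℝ)) : ℂ)) ^ j *
        Complex.exp (2 * π * Complex.I * j * t / (2 * M + 1 : ℕ)) := by
  have hn0 : ((2 * M + 1 : ℕ) : ℂ) ≠ 0 := by exact_mod_cast (show 2 * M + 1 ≠ 0 by omega)
  rw [← Complex.exp_nat_mul, ← Complex.exp_nat_mul, ← Complex.exp_add]
  congr 1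
  push_cast
  field_simp

/-- kernel: the conjugate of a root-of-unity phase. [folklore] -/
private theorem hconj (M j' : ℕ) (t : ℤ) :
    conj (Complex.exp (2 * π * Complex.I * (j' : ℂ) * (t : ℂ) / ((2 * M + 1 : ℕ) : ℂ))) =
      Complex.exp (-(2 * π * Complex.I * (j' : ℂ) * (t : ℂ) / ((2 * M + 1 : ℕ) : ℂ))) := by
  rw [← Complex.exp_conj]
  congr 1
  simp only [map_div₀, map_mul, map_ofNat, Complex.conj_ofReal, Complex.conj_I, map_natCast, map_intCast]
  ring

/-- kernel: combining two root-of-unity phases. [folklore] -/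
private theorem exp_combine (M j j' : ℕ) (t : ℤ) :
    Complex.exp (2 * π * Complex.I * (j : ℂ) * (t : ℂ) / ((2 * M + 1 : ℕ) : ℂ)) *
        Complex.exp (-(2 * π * Complex.I * (j' : ℂ) * (t : ℂ) / ((2 * M + 1 : ℕ) : ℂ))) =
      Complex.exp (2 * π * Complex.I * ((((j : ℤ) - j' : ℤ)) : ℂ) * t / (2 * M + 1 : ℕ)) := by
  rw [← Complex.exp_add]
  congr 1
  push_cast
  ring

/-- **Σ_{|t| ≤ M} |v(x + 2πt)|² = 1** for the block-average symbol (n = 2M + 1, every real x): the Plancherel identity behind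
(2.19) *"QQ^{s*} = I"* and (2.24) at one coordinate. [cite: BalabanImbrieJaffe1985, (2.24) p.305] -/
theorem sum_norm_v1_sq (M : ℕ) (x : ℝ) :
    ∑ t ∈ Finset.Icc (-(M : ℤ)) M, ‖v1 (2 * M + 1) (x + 2 * π * t)‖ ^ 2 = 1 := by
  have hn0 : ((2 * M + 1 : ℕ) : ℂ) ≠ 0 := by exact_mod_cast (show 2 * M + 1 ≠ 0 by omega)
  apply Complex.ofReal_injective
  push_cast
  -- |v|² = v v̄, expanded as a double sum
  have hexp : ∀ t : ℤ, (((‖v1 (2 * M + 1) (x + 2 * π * t)‖ : ℝ) : ℂ)) ^ 2 =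
      (((2 * M + 1 : ℕ) : ℂ))⁻¹ ^ 2 * ∑ j ∈ Finset.range (2 * M + 1), ∑ j' ∈ Finset.range (2 * M + 1),
        (Complex.exp (Complex.I * (((((2 * M + 1 : ℕ) : ℝ)⁻¹ * x : ℝ)) : ℂ)) ^ j *
          conj (Complex.exp (Complex.I * (((((2 * M + 1 : ℕ) : ℝ)⁻¹ * x : ℝ)) : ℂ)) ^ j')) *
        Complex.exp (2 * π * Complex.I * ((j : ℤ) - j' : ℤ) * t / (2 * M + 1 : ℕ)) := by
    intro t
    rw [← Complex.ofReal_pow, ← Complex.normSq_eq_norm_sq, ← Complex.mul_conj, v1]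
    simp only [map_mul, map_sum, map_inv₀, Complex.conj_natCast, exp_pow_shift]
    rw [show ∀ a S T : ℂ, a * S * (a * T) = a ^ 2 * (S * T) from fun a S T => by ring]
    congr 1
    rw [Finset.sum_mul_sum]
    refine Finset.sum_congr rfl fun j _ => Finset.sum_congr rfl fun j' _ => ?_
    rw [hconj M j' t, mul_mul_mul_comm, exp_combine M j j' t]
  simp_rw [hexp]
  rw [← Finset.mul_sum, Finset.sum_comm]
  simp_rw [Finset.sum_comm (s := Finset.Icc (-(M : ℤ)) M), ← Finset.mul_sum]
  -- apply the root-of-unity sum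
  have hin : ∀ j ∈ Finset.range (2 * M + 1), ∀ j' ∈ Finset.range (2 * M + 1), |((j : ℤ) - j')| < (2 * M + 1 : ℕ) := by
    intro j hj j' hj'
    simp only [Finset.mem_range] at hj hj'
    rw [abs_lt]
    constructor <;> omega
  rw [Finset.sum_congr rfl fun j hj => Finset.sum_congr rfl fun j' hj' => by rw [sum_root_unity M (hin j hj j' hj')]]
  simp only [sub_eq_zero, Int.natCast_inj, mul_ite, mul_zero, Finset.sum_ite_eq, Finset.mem_range]
  rw [Finset.sum_congr rfl fun j hj => by rw [if_pos (Finset.mem_range.mp hj), exp_pow_mul_conj, one_mul]]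
  simp only [Finset.sum_const, Finset.card_range, nsmul_eq_mul]
  field_simp

/-! ## §3 The sums over all shifts: (2.19) QQ^{s*} = I and (2.24) Q^e_kQ^{e*}_k = η^{−2}, Q^s_kQ^{s*}_k = η^{−1} at the fibre -/

/-- kernel: Σ_{m} Π_ρ g_ρ(m_ρ) over the full shift set, with g_ρ ≡ 1 on the directions in S and |v|² elsewhere, is n^{|S|}.
[folklore] -/
private theorem sum_prod_ite (M : ℕ) (p : Fin d → ℝ) (S : Finset (Fin d)) :
    ∑ m ∈ lShifts d M, ∏ ρ, (if ρ ∈ S then (1 : ℝ) else ‖v1 (2 * M + 1) (p ρ + 2 * π * (m ρ))‖ ^ 2) =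
      ((2 * M + 1 : ℕ) : ℝ) ^ S.card := by
  have key := (Finset.prod_univ_sum (fun _ : Fin d => Finset.Icc (-(M : ℤ)) M)
    (fun (ρ : Fin d) (t : ℤ) => if ρ ∈ S then (1 : ℝ) else ‖v1 (2 * M + 1) (p ρ + 2 * π * (t : ℤ))‖ ^ 2)).symm
  rw [lShifts, key]
  rw [Finset.prod_congr rfl fun ρ _ => show (∑ t ∈ Finset.Icc (-(M : ℤ)) M,
      (if ρ ∈ S then (1 : ℝ) else ‖v1 (2 * M + 1) (p ρ + 2 * π * (t : ℤ))‖ ^ 2)) =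
      if ρ ∈ S then ((2 * M + 1 : ℕ) : ℝ) else 1 from by
    split_ifs with h
    · simp only [Finset.sum_const, Int.card_Icc, nsmul_eq_mul, mul_one]
      norm_cast
      omega
    · exact sum_norm_v1_sq M (p ρ)]
  rw [Finset.prod_ite_mem, Finset.univ_inter, Finset.prod_const]

/-- kernel: dividing the product of the |v_ρ|² by the factors in S leaves the product of the others. [folklore] -/
private theorem prod_div_prod_eq (V : Fin d → ℝ) (S : Finset (Fin d)) (hV : ∏ ρ ∈ S, V ρ ≠ 0) :
    (∏ ρ, V ρ) / ∏ ρ ∈ S, V ρ = ∏ ρ, (if ρ ∈ S then (1 : ℝ) else V ρ) := by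
  rw [div_eq_iff hV, ← Finset.prod_sdiff (Finset.subset_univ S), ← Finset.prod_sdiff (Finset.subset_univ S)
    (f := fun ρ => if ρ ∈ S then (1 : ℝ) else V ρ)]
  rw [Finset.prod_congr rfl fun ρ hρ => show (if ρ ∈ S then (1 : ℝ) else V ρ) = V ρ from
      if_neg (Finset.mem_sdiff.mp hρ).2,
    Finset.prod_congr rfl fun ρ hρ => show (if ρ ∈ S then (1 : ℝ) else V ρ) = 1 from if_pos hρ,
    Finset.prod_const_one, mul_one]

/-- At the scales n = 2M + 1 and a generic p′, |v_ρ(p′+l)|² (r15's `vSym`) is the block-average modulus |v1(p′_ρ + l_ρ)|².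
[cite: BalabanImbrieJaffe1985, (7.1.7) p.322] -/
theorem norm_vSym_sq_eq (M : ℕ) {p : Fin d → ℝ} (hp : ∀ i, p i ≠ 0 ∧ |p i| ≤ π) (m : Fin d → ℤ) (ρ : Fin d) :
    ‖vSym (((2 * M + 1 : ℕ) : ℝ)⁻¹) (shiftMom p m) ρ‖ ^ 2 = ‖v1 (2 * M + 1) (p ρ + 2 * π * (m ρ))‖ ^ 2 := by
  rw [← vC_shift_eq_vSym (by omega) hp m ρ, vC_eq_v1]
  rfl

/-- **Σ_l |u(p′+l)|² = 1** over the full shift set l ∈ 2πZ^d, |l_i| ≤ πn (n = 2M + 1, EVERY p′) for the block-average symbol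
u = Πv (this seat's `uC`): [6I] p. 23 / the symbol form of QQ^* = I for sites. [cite: BalabanImbrieJaffe1985, (2.19) p.305] -/
theorem sum_norm_uC_sq (M : ℕ) (p : Fin d → ℝ) :
    ∑ m ∈ lShifts d M, ‖uC (2 * M + 1) (shiftMom p m)‖ ^ 2 = 1 := by
  have h := sum_prod_ite M p ∅
  simp only [Finset.notMem_empty, if_false, Finset.card_empty, pow_zero] at h
  refine Eq.trans (Finset.sum_congr rfl fun m _ => ?_) h
  rw [uC, norm_prod, ← Finset.prod_pow]
  rfl

/-- **(2.19) QQ^{s*} = I at the fibre**: Σ_l r_ν(p′+l)·\bar{s}_ν(p′+l) = 1 for the bond weight r = uv_ν and the surface weight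
s = u/v̄_ν, at every generic p′ (n = 2M + 1). [cite: BalabanImbrieJaffe1985, (2.19) p.305] -/
theorem sum_rQ_mul_conj_sW (M : ℕ) {p : Fin d → ℝ} (hp : ∀ i, p i ≠ 0 ∧ |p i| ≤ π)
    (hG : Generic (((2 * M + 1 : ℕ) : ℝ)⁻¹) M p) (ν : Fin d) :
    ∑ m ∈ lShifts d M, rQ (((2 * M + 1 : ℕ) : ℝ)⁻¹) p m ν * conj (sW (((2 * M + 1 : ℕ) : ℝ)⁻¹) p m ν) = 1 := by
  rw [Finset.sum_congr rfl fun m hm => rQ_mul_conj_sW hG hm ν, ← Complex.ofReal_one, ← sum_norm_uC_sq M p,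
    Complex.ofReal_sum]
  refine Finset.sum_congr rfl fun m _ => ?_
  rw [uC_shift_eq_uSym (by omega) hp m]

/-- **(2.24) Q^s_kQ^{s*}_k = η^{−1}I at the fibre**: Σ_l |s_ν(p′+l)|² = n for the surface weight s = u/v̄_ν (generic p′, n = 2M + 1).
[cite: BalabanImbrieJaffe1985, (2.24) p.305] -/
theorem sum_norm_sW_sq (M : ℕ) {p : Fin d → ℝ} (hp : ∀ i, p i ≠ 0 ∧ |p i| ≤ π)
    (hG : Generic (((2 * M + 1 : ℕ) : ℝ)⁻¹) M p) (ν : Fin d) :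
    ∑ m ∈ lShifts d M, ‖sW (((2 * M + 1 : ℕ) : ℝ)⁻¹) p m ν‖ ^ 2 = (2 * M + 1 : ℕ) := by
  have h := sum_prod_ite M p {ν}
  rw [Finset.card_singleton, pow_one] at h
  refine Eq.trans (Finset.sum_congr rfl fun m hm => ?_) h
  have hV : ∏ ρ ∈ ({ν} : Finset (Fin d)), ‖vSym (((2 * M + 1 : ℕ) : ℝ)⁻¹) (shiftMom p m) ρ‖ ^ 2 ≠ 0 := by
    rw [Finset.prod_singleton]; exact pow_ne_zero _ (norm_ne_zero_iff.mpr (vSym_ne hG hm ν))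
  calc ‖sW (((2 * M + 1 : ℕ) : ℝ)⁻¹) p m ν‖ ^ 2
      = (∏ ρ, ‖vSym (((2 * M + 1 : ℕ) : ℝ)⁻¹) (shiftMom p m) ρ‖ ^ 2) /
          ∏ ρ ∈ ({ν} : Finset (Fin d)), ‖vSym (((2 * M + 1 : ℕ) : ℝ)⁻¹) (shiftMom p m) ρ‖ ^ 2 := by
        rw [Finset.prod_singleton, sW, norm_div, div_pow, Complex.norm_conj, uSym_eq_prod, norm_prod, Finset.prod_pow]
    _ = ∏ ρ, (if ρ ∈ ({ν} : Finset (Fin d)) then (1 : ℝ) else ‖vSym (((2 * M + 1 : ℕ) : ℝ)⁻¹) (shiftMom p m) ρ‖ ^ 2) :=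
        prod_div_prod_eq _ _ hV
    _ = ∏ ρ, (if ρ ∈ ({ν} : Finset (Fin d)) then (1 : ℝ) else ‖v1 (2 * M + 1) (p ρ + 2 * π * (m ρ))‖ ^ 2) :=
        Finset.prod_congr rfl fun ρ _ => by
          by_cases h : ρ ∈ ({ν} : Finset (Fin d)) <;> simp only [h, if_true, if_false, norm_vSym_sq_eq M hp m ρ]

/-- **(2.24) Q^e_kQ^{e*}_k = η^{−2}I at the fibre**: Σ_l |w_{μν}(p′+l)|² = n² for the edge weight w = u/(v̄_μv̄_ν), μ ≠ ν (generic
p′, n = 2M + 1) — the identity behind the second form of (4.2.2)/(7.1.12), *"Here we have used Q^e_kQ^{e*}_k = η^{−2}, see (2.24)"*.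
[cite: BalabanImbrieJaffe1985, (2.24) p.305] -/
theorem sum_norm_wE_sq (M : ℕ) {p : Fin d → ℝ} (hp : ∀ i, p i ≠ 0 ∧ |p i| ≤ π)
    (hG : Generic (((2 * M + 1 : ℕ) : ℝ)⁻¹) M p) {μ ν : Fin d} (hμν : μ ≠ ν) :
    ∑ m ∈ lShifts d M, ‖wE (((2 * M + 1 : ℕ) : ℝ)⁻¹) p m μ ν‖ ^ 2 = ((2 * M + 1 : ℕ) : ℝ) ^ 2 := by
  have h := sum_prod_ite M p {μ, ν}
  rw [Finset.card_pair hμν] at h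
  refine Eq.trans (Finset.sum_congr rfl fun m hm => ?_) h
  have hV : ∏ ρ ∈ ({μ, ν} : Finset (Fin d)), ‖vSym (((2 * M + 1 : ℕ) : ℝ)⁻¹) (shiftMom p m) ρ‖ ^ 2 ≠ 0 := by
    rw [Finset.prod_pair hμν]
    exact mul_ne_zero (pow_ne_zero _ (norm_ne_zero_iff.mpr (vSym_ne hG hm μ)))
      (pow_ne_zero _ (norm_ne_zero_iff.mpr (vSym_ne hG hm ν)))
  calc ‖wE (((2 * M + 1 : ℕ) : ℝ)⁻¹) p m μ ν‖ ^ 2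
      = (∏ ρ, ‖vSym (((2 * M + 1 : ℕ) : ℝ)⁻¹) (shiftMom p m) ρ‖ ^ 2) /
          ∏ ρ ∈ ({μ, ν} : Finset (Fin d)), ‖vSym (((2 * M + 1 : ℕ) : ℝ)⁻¹) (shiftMom p m) ρ‖ ^ 2 := by
        rw [Finset.prod_pair hμν, wE, norm_div, div_pow, norm_mul, mul_pow, Complex.norm_conj, Complex.norm_conj,
          uSym_eq_prod, norm_prod, Finset.prod_pow]
    _ = ∏ ρ, (if ρ ∈ ({μ, ν} : Finset (Fin d)) then (1 : ℝ) else ‖vSym (((2 * M + 1 : ℕ) : ℝ)⁻¹) (shiftMom p m) ρ‖ ^ 2) :=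
        prod_div_prod_eq _ _ hV
    _ = ∏ ρ, (if ρ ∈ ({μ, ν} : Finset (Fin d)) then (1 : ℝ) else ‖v1 (2 * M + 1) (p ρ + 2 * π * (m ρ))‖ ^ 2) :=
        Finset.prod_congr rfl fun ρ _ => by
          by_cases h : ρ ∈ ({μ, ν} : Finset (Fin d)) <;> simp only [h, if_true, if_false, norm_vSym_sq_eq M hp m ρ]

/-! ## §4 The second form of (4.2.2)/(7.1.12): σ_k = η^{−2}I − Q^e_k∂G_{k,Ax}∂^*Q^{e*}_k at the fibre -/

/-- **‖Q^{e*}_kf‖² = η^{−2}‖f‖²** for every two-form f at a generic fibre (n = 2M + 1): the (2.20)-norm of Q^{e*}_kf is n²·½Σ_{μν}|f_{μν}|²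
(gen-2 `normSq` counts ordered pairs). [cite: BalabanImbrieJaffe1985, (2.24) p.305] -/
theorem pNormSq_qeStar (M : ℕ) {p : Fin d → ℝ} (hp : ∀ i, p i ≠ 0 ∧ |p i| ≤ π)
    (hG : Generic (((2 * M + 1 : ℕ) : ℝ)⁻¹) M p) {f : Fin d → Fin d → ℂ} (hf : IsTwoForm f) :
    pNormSq M (qeStar (((2 * M + 1 : ℕ) : ℝ)⁻¹) p f) = ((2 * M + 1 : ℕ) : ℝ) ^ 2 * (1 / 2 * BIJ85CurlComplement719.normSq f) := by
  have hterm : ∀ μ ν, ∑ m ∈ lShifts d M, ‖qeStar (((2 * M + 1 : ℕ) : ℝ)⁻¹) p f m μ ν‖ ^ 2 =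
      ((2 * M + 1 : ℕ) : ℝ) ^ 2 * ‖f μ ν‖ ^ 2 := by
    intro μ ν
    by_cases hμν : μ = ν
    · subst hμν
      have h0 : f μ μ = 0 := by
        have := hf μ μ
        linear_combination (1 / 2 : ℂ) * this
      simp [qeStar, h0]
    · simp only [qeStar, norm_mul, mul_pow, Complex.norm_conj]
      rw [← Finset.sum_mul, sum_norm_wE_sq M hp hG hμν]
  unfold pNormSq BIJ85CurlComplement719.normSq
  calc 1 / 2 * ∑ m ∈ lShifts d M, ∑ μ, ∑ ν, ‖qeStar (((2 * M + 1 : ℕ) : ℝ)⁻¹) p f m μ ν‖ ^ 2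
      = 1 / 2 * ∑ μ, ∑ ν, ∑ m ∈ lShifts d M, ‖qeStar (((2 * M + 1 : ℕ) : ℝ)⁻¹) p f m μ ν‖ ^ 2 := by
        congr 1
        rw [Finset.sum_comm]
        exact Finset.sum_congr rfl fun μ _ => Finset.sum_comm
    _ = 1 / 2 * ∑ μ, ∑ ν, ((2 * M + 1 : ℕ) : ℝ) ^ 2 * ‖f μ ν‖ ^ 2 := by
        congr 1
        exact Finset.sum_congr rfl fun μ _ => Finset.sum_congr rfl fun ν _ => hterm μ ν
    _ = ((2 * M + 1 : ℕ) : ℝ) ^ 2 * (1 / 2 * ∑ μ, ∑ ν, ‖f μ ν‖ ^ 2) := by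
        simp only [← Finset.mul_sum]
        ring

/-- ⟨Y, X⟩ = \overline{⟨X, Y⟩} for the pairing (2.20). [folklore] [cite: BalabanImbrieJaffe1985, (2.20) p.305] -/
theorem pInner_conj_symm (M : ℕ) (X Y : (Fin d → ℤ) → Fin d → Fin d → ℂ) :
    pInner M Y X = conj (pInner M X Y) := by
  unfold pInner
  simp only [map_mul, map_sum, Complex.conj_conj, map_div₀, map_one, map_ofNat]
  congr 1
  exact Finset.sum_congr rfl fun m _ => Finset.sum_congr rfl fun μ _ => Finset.sum_congr rfl fun ν _ => mul_comm _ _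

/-- **(4.2.2)/(7.1.12), second form, at the fibre**: ⟨f, σ_k(p′)f⟩ = η^{−2}‖f‖² − ‖∂A*‖², where ∂A* = ∂G_{k,Ax}∂^*Q^{e*}_kf is the
projection of Q^{e*}_kf onto the constrained curls (`normal_eq`) — *"σ_k = Q^e_k(I − ∂G_{k,Ax}∂^*)Q^{e*}_k =
η^{−2}I − Q^e_k∂G_{k,Ax}∂^*Q^{e*}_k. (4.2.2) Here we have used Q^e_kQ^{e*}_k = η^{−2}, see (2.24)"* — for every two-form f at every
generic fibre, n = 2M + 1. [cite: BalabanImbrieJaffe1985, (4.2.2) p.310] -/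
theorem sigmaMin_eq_second_form (M : ℕ) {p : Fin d → ℝ} (hp : ∀ i, p i ≠ 0 ∧ |p i| ≤ π)
    (hG : Generic (((2 * M + 1 : ℕ) : ℝ)⁻¹) M p) {f : Fin d → Fin d → ℂ} (hf : IsTwoForm f) :
    sigmaMin (((2 * M + 1 : ℕ) : ℝ)⁻¹) M p f = ((2 * M + 1 : ℕ) : ℝ) ^ 2 * (1 / 2 * BIJ85CurlComplement719.normSq f) -
      pNormSq M (curlF (((2 * M + 1 : ℕ) : ℝ)⁻¹) p (minimiser (((2 * M + 1 : ℕ) : ℝ)⁻¹) M p f)) := by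
  have hval : sigmaMin (((2 * M + 1 : ℕ) : ℝ)⁻¹) M p f =
      pNormSq M (fun m μ ν => qeStar (((2 * M + 1 : ℕ) : ℝ)⁻¹) p f m μ ν -
        curlF (((2 * M + 1 : ℕ) : ℝ)⁻¹) p (minimiser (((2 * M + 1 : ℕ) : ℝ)⁻¹) M p f) m μ ν) := by
    rw [(sigmaMin_eq hG hf).1, ← energy_minimiser hG hf, Complex.ofReal_re]
    unfold energy pNormSq
    congr 1
    exact Finset.sum_congr rfl fun m _ => Finset.sum_congr rfl fun μ _ => Finset.sum_congr rfl fun ν _ => by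
      rw [norm_sub_rev]
  have hcross : (pInner M (fun m μ ν => qeStar (((2 * M + 1 : ℕ) : ℝ)⁻¹) p f m μ ν -
      curlF (((2 * M + 1 : ℕ) : ℝ)⁻¹) p (minimiser (((2 * M + 1 : ℕ) : ℝ)⁻¹) M p f) m μ ν)
      (curlF (((2 * M + 1 : ℕ) : ℝ)⁻¹) p (minimiser (((2 * M + 1 : ℕ) : ℝ)⁻¹) M p f))).re = 0 := by
    rw [pInner_conj_symm, Complex.conj_re, normal_eq hG hf (qOp_minimiser hG f), Complex.zero_re]
  have hsplit := pNormSq_add (M := M)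
    (fun m μ ν => qeStar (((2 * M + 1 : ℕ) : ℝ)⁻¹) p f m μ ν -
      curlF (((2 * M + 1 : ℕ) : ℝ)⁻¹) p (minimiser (((2 * M + 1 : ℕ) : ℝ)⁻¹) M p f) m μ ν)
    (curlF (((2 * M + 1 : ℕ) : ℝ)⁻¹) p (minimiser (((2 * M + 1 : ℕ) : ℝ)⁻¹) M p f))
  simp only [sub_add_cancel] at hsplit
  rw [hcross, mul_zero, add_zero, show (fun m μ ν => qeStar (((2 * M + 1 : ℕ) : ℝ)⁻¹) p f m μ ν) =
    qeStar (((2 * M + 1 : ℕ) : ℝ)⁻¹) p f from rfl, pNormSq_qeStar M hp hG hf] at hsplit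
  rw [hval]
  linarith

end

end Literature.MathematicalPhysics.QuantumFieldTheory.BalabanImbrieJaffe1984to88.BIJ85Eq7113DerivationPart4
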